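import Mathlib
import Literature.MathematicalPhysics.QuantumFieldTheory.Balaban1983to89.B14InterpolationMeasure

/-!
# `Balaban1983to89.B14.Eq338Localization` — [Balaban1988Convergent] (3.31) p. 273, (3.37)–(3.38) p. 274, (3.41)–(3.42)
# p. 275: the bond-wise inner product, the per-bond localization `𝐄₀^{(k+1)}(Λ_{k+1}, b)` of the logarithm in (3.28), the
# sentence "The identities (3.30)–(3.33), (3.36), together with the above definition, imply the equality (3.38)" PROVED as
# bookkeeping, the per-site localization (3.41) AS PRINTED (with the half-shared coarse bonds) and (3.38) ⇒ (3.42) PROVED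

statement-level skeleton of published theorems with citation tags; proofs where landed; nothing here is a
claim about the Yang–Mills mass gap

PDF held: `paper:balaban1988-cmp119-convergent-renormalization` (journal page = PDF page + 242); (3.30) read on the x2
render `…-p030-x2.png` (p. 272), (3.31)–(3.33) on `…-p031-x2.png` (p. 273), (3.36)–(3.39) on `…-p032-x2.png` (p. 274),
(3.40)–(3.42) on `…-p033-x2.png` (p. 275) of
`run/shared/lean/pub/pub-balaban/b2b-balaban-ref1/pages/1988-cmp119-convergent-renormalization/`.

CITATION HEADER (lean-in-tree rule).  Source: T. Bałaban, *Convergent renormalization expansions for lattice gauge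
theories*, Commun. Math. Phys. **119**, 243–285 (1988), doi:10.1007/bf01217741 [Balaban1988Convergent] (cell paper B14 =
"[III]").  Mega-formalization `lit-balaban` (HOME `run/shared/lean/pub/lit-balaban/`), reader/typer unit `lit-balaban-r11`
(generation 3), SKELETON rows **B14.Eq3.31–3.32** ((3.31) display was absent), **B14.Eq3.37–3.39** ((3.37), (3.38) absent)
and **B14.Eq3.41–3.42** ((3.41) as a named definition absent; the ROWS-B14 ≤ v1.11 informal text of (3.41) omitted the
half-shared `log z^{(k)}` terms — corrected here from the render p033).

THE PRINTED TEXT (verbatim).  p. 273 [PDF 31]: *"Thus the derivatives in the expectation value can be written as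
  ⟨𝐕_k′(tg_k, A), CA⟩ = Σ_{b∈Λ^{(k)}_{k+1}} tr 𝐕_k′(tg_k, A, b)(CA)(b),   (3.31)
where 𝐕_k′ is the sum of all the functional derivatives. Consider the second logarithm on the right-hand side of (3.30).
Denote the characteristic function with the parameter t multiplying the variables A by χ_t^{(k)}. Thus there is the function
χ_1^{(k)} in this expression, and χ_0^{(k)} = 1. We have
  log ∫ dμ_{C^{(k)}(Λ_{k+1})} χ_1^{(k)} = ∫₀¹ dt ∫ dμ_{C^{(k)}(Λ_{k+1})} (∂/∂t)χ_t^{(k)} (∫ dμ_{C^{(k)}(Λ_{k+1})} χ_t^{(k)})⁻¹,   (3.32)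
and (∂/∂t)χ_t^{(k)} can be written as a sum of terms, for which only one characteristic function in the product is
differentiated."*  p. 274 [PDF 32]: *"Let us introduce the following definiton:
  𝐄₀^{(k+1)}(Λ_{k+1}, U_{k+1}, b) = χ_{Λ^{(k)*}_{k+1}}(b) [ −½ log λ₀ + ½ ∫₀^∞ dλ (λ₀ + λ)⁻¹
      · tr((C*Δ^{(k)}C − λ₀I)(C*Δ^{(k)}C + λ)⁻¹)(b, b)
      + ∫₀¹ dt ∫ dμ_{C^{(k)}(Λ_{k+1})} Π_{b′∈Λ^{(k)*}_{k+1}, b′≠b} χ^{(k)}(tA(b′)) (∂/∂t)χ^{(k)}(tA(b)) · (∫ dμ_{C^{(k)}(Λ_{+1})} χ_t^{(k)})⁻¹ ]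
      + g_k ∫₀¹ dt ⟨tr 𝐕_k′(tg_k, A, b)(CA)(b)⟩_t .   (3.37)
The identities (3.30)–(3.33), (3.36), together with the above definition, imply the equality
  [the logarithm on the right-hand side of (3.28)] = Σ_{c∈Λ^{(k+1)}_{k+1}} log z^{(k)}(c) + Σ_{b∈Λ^{(k)}_{k+1}} 𝐄₀^{(k+1)}(Λ_{k+1}, b) + const .   (3.38)
The constant above is the constant in (3.33), included into the vacuum renormalization E₀^{(k)}."*  p. 275 [PDF 33]:
*"With the help of these functions we define
  𝐄₀^{(k+1)}(Λ_{k+1}, U_{k+1}, z) = Σ_{μ=1}^{d} [ ½ (log z^{(k)}(⟨z − Le_μ, z⟩) + log z^{(k)}(⟨z, z + Le_μ⟩))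
      + Σ_x h_z(x) 𝐄₀^{(k+1)}(Λ_{k+1}, ⟨x, x + e_μ⟩) ],  z ∈ Λ^{(k+1)}_{k+1} .   (3.41)
This function has the same properties as the function (3.37), namely it is gauge invariant, and, when defined on the whole
lattice, it is Euclidean covariant, i.e. it satisfies the inductive assumption (2.29) for j = k + 1. The equality (3.38)
implies  [the logarithm on the right-hand side of (3.28)] = Σ_{z∈Λ^{(k+1)}_{k+1}} 𝐄₀^{(k+1)}(Λ_{k+1}, z) + const .   (3.42)"*
And (3.30) p. 272: *"[the logarithm on the right-hand side of (3.28)] = log[z^{(k)} ∫ dA exp[−½⟨A, C*Δ^{(k)}CA⟩]]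
+ log ∫ dμ_{C^{(k)}(Λ_{k+1})} χ^{(k)} + g_k ∫₀¹ dt ⟨(∂/∂tg_k) 𝐏^{(k)}(tg_k, A) + (∂/∂tg_k) 𝐄_k(U_k(…tg_kCA…))⟩_t ."*
NB the sign of the `½ ∫₀^∞` term printed in (3.36)/(3.37): the tree file `…B14LogDet336Matrix` proves the CORRECTED
identity with `−½ ∫₀^∞` (`eq336_corrected`, `eq336_printed_fails_smul_one`, cell DIVERGENCE D-pv02.5); this file takes the
Gaussian bracket as an abstract per-bond function, so the erratum does not enter.

THE MODEL AND WHAT IS TYPED.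
* (3.31): bond functions with values in `n × n` complex matrices (the Lie algebra in a matrix realisation), `bondInner V W =
  Σ_b tr(V(b) W(b))` — the display read as the DEFINITION of the inner product on 𝔤-valued bond functions (`bondInner`,
  `bondInner_comm`, `bondInner_add_left`, `bondInner_smul_left`, `star_bondInner`/`bondInner_im` — real for Hermitian data).
* (3.32)'s derivative: the characteristic function `χ_t^{(k)} = Π_{b∈Λ^{(k)*}_{k+1}} χ^{(k)}(tA(b))` is `chiProd star χ t ω`
  for an abstract family of per-bond factors `χ b t ω` (= `χ^{(k)}(tA(ω)(b))`, `ω` the fluctuation-field point, `star ⊂ β`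
  the bond set `Λ^{(k)*}_{k+1}` inside the bond type `β = Λ^{(k)}_{k+1}`), and the sentence *"(∂/∂t)χ_t^{(k)} can be written as a
  sum of terms, for which only one characteristic function in the product is differentiated"* is `dchiProd` +
  **`hasDerivAt_chiProd`** (Leibniz rule, PROVED from per-factor derivatives).
* (3.37): `E0 star gaussB chiB g vB b = χ_star(b)·[gaussB b + chiB b] + g·vB b` — the printed three-piece structure, with the
  second and third pieces CONCRETE: `chiBracket ν star χ χ' b = ∫₀¹ dt (∫ Π_{b′≠b} χ_{b′} ∂_tχ_b dν)(∫ χ_t dν)⁻¹` and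
  `vBracket Ex f b = ∫₀¹ dt ⟨f_b⟩_t` for an expectation family `Ex t` (= `⟨·⟩_t` of (3.30); the tree's
  `B14.InterpolationMeasure.gibbsExpect ν w S · t` is the instance of record, additivity `gibbsExpect_finset_sum` PROVED) and
  `f b t ω = tr 𝐕_k′(tg_k, A(ω), b)(CA(ω))(b)` abstract; the FIRST (Gaussian) piece `gaussB b` is an abstract per-bond real —
  its concrete form and the identity (3.33)+(3.36) ⇒ "Σ_b gaussB b = log[z^{(k)}∫dA e^{−½⟨A,C*Δ^{(k)}CA⟩}] − Σ_c log z^{(k)}(c)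
  − const" are the tree theorems `B14Eq333Proof.eq338_gaussianPart_fiber` / `B14LogDet336Matrix.sum_fiber_eq337_first`
  (p28, b2b-pv02), entering here as the hypothesis `h333` (not re-proved, not imported: farm-cone independence).
* (3.38): **`eq338`** — PROVED: from (3.30) (hypothesis `h330`, its last integrand already in the bond form (3.31):
  `⟨Σ_b f_b⟩_t`), (3.33)/(3.36) (`h333`) and (3.32) with the Leibniz form of the derivative (`h332`; tree:
  `B14.InterpolationMeasure.DomFamily.eq332_family`), under the integrability binders making every `∫` a genuine integral,
  `[the logarithm] = Σ_c log z^{(k)}(c) + Σ_b E0 … b + const` — the content being the interchanges `∫dμ Σ_b = Σ_b ∫dμ`,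
  `∫₀¹dt Σ_b = Σ_b ∫₀¹dt`, `⟨Σ_b ·⟩_t = Σ_b ⟨·⟩_t` and the indicator bookkeeping of `χ_{Λ*}(b)`.
* (3.41): **`E0site`** — AS PRINTED: coarse sites `Z`, fine sites `X`, directions `Fin d`; coarse bonds `⟨z, z+Le_μ⟩ ↔ (z, μ)`,
  `⟨z − Le_μ, z⟩ ↔ (back μ z, μ)`; fine bonds `⟨x, x+e_μ⟩ ↔ (x, μ)`; `h z x = h_z(x)` the tent weights of (3.40).
* (3.42): **`sum_E0site`** / **`eq342`** — PROVED on the whole (periodic) lattice, i.e. when each `back μ` is a bijection of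
  the coarse sites and `Σ_z h_z(x) = 1` ((3.40): tree `B14.TentUnityTorus.tentT_decomposition_unity`,
  `B14.TentUnity.tentD_decomposition_unity`): `Σ_c log z^{(k)}(c) + Σ_b 𝐄₀(b) = Σ_z 𝐄₀(z)`, hence (3.38) ⇒ (3.42) with the
  same constant.  SCOPE: on a proper subdomain `Λ_{k+1}` the half-bonds `½ log z^{(k)}` at `∂Λ^{(k+1)}_{k+1}` are a boundary
  bookkeeping the print does not display ("when defined on the whole lattice", p. 275) — TODO(general form).
NOT HERE: the objects `z^{(k)}(c)`, `C`, `Δ^{(k)}`, `χ^{(k)}`, `𝐕_k′`, `⟨·⟩_t` of Bałaban's spaces (abstract data); (3.30),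
(3.32), (3.33), (3.36) themselves (tree: `B14.Interpolation.Eq330`/`B14.InterpolationMeasure.eq330_gibbs`, `eq332_family`,
`B14.GaussianDet333.eq333`, `B14LogDet336Matrix.eq336_corrected`); gauge invariance / Euclidean covariance (3.39) of the
pieces (row B14.Eq3.37–3.39: `Step.LFNewCov`).  No `sorry`.
-/

noncomputable section

open _root_.MeasureTheory _root_.Set Finset
open scoped BigOperators

namespace Literature.MathematicalPhysics.QuantumFieldTheory.Balaban1983to89.B14.Eq338Localization

/-! ## §1. (3.31): the inner product on Lie-algebra-valued bond functions, bond by bond -/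

section Inner

variable {β : Type*} [Fintype β] {n : Type*} [Fintype n]

/-- **(3.31)**: `⟨V, W⟩ = Σ_{b} tr V(b) W(b)` — the inner product of two matrix-valued bond functions written bond-wise (in
print `V = 𝐕_k′(tg_k, A, ·)`, the sum of all the functional derivatives, and `W = CA`).
[cite: Balaban1988Convergent, (3.31) p.273] -/
def bondInner (V W : β → Matrix n n ℂ) : ℂ := ∑ b, Matrix.trace (V b * W b)

/-- Symmetry of (3.31): `Σ_b tr V(b)W(b) = Σ_b tr W(b)V(b)`. [cite: Balaban1988Convergent, (3.31) p.273] -/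
theorem bondInner_comm (V W : β → Matrix n n ℂ) : bondInner V W = bondInner W V :=
  Finset.sum_congr rfl fun b _ => Matrix.trace_mul_comm (V b) (W b)

/-- Additivity of (3.31) in the first slot (𝐕_k′ *"is the sum of all the functional derivatives"*).
[cite: Balaban1988Convergent, (3.31) p.273] -/
theorem bondInner_add_left (V₁ V₂ W : β → Matrix n n ℂ) :
    bondInner (V₁ + V₂) W = bondInner V₁ W + bondInner V₂ W := by
  simp only [bondInner, Pi.add_apply, add_mul, Matrix.trace_add, Finset.sum_add_distrib]

/-- Homogeneity of (3.31) in the first slot. [cite: Balaban1988Convergent, (3.31) p.273] -/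
theorem bondInner_smul_left (c : ℂ) (V W : β → Matrix n n ℂ) :
    bondInner (c • V) W = c * bondInner V W := by
  simp only [bondInner, Pi.smul_apply, Matrix.smul_mul, Matrix.trace_smul, smul_eq_mul, Finset.mul_sum]

/-- For Hermitian bond data (`A = (1/i) log U` Hermitian in the matrix realisation) the pairing (3.31) is self-conjugate …
[cite: Balaban1988Convergent, (3.31) p.273] -/
theorem star_bondInner {V W : β → Matrix n n ℂ} (hV : ∀ b, (V b).IsHermitian) (hW : ∀ b, (W b).IsHermitian) :
    star (bondInner V W) = bondInner V W := by
  unfold bondInner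
  rw [star_sum]
  refine Finset.sum_congr rfl fun b _ => ?_
  rw [← Matrix.trace_conjTranspose, Matrix.conjTranspose_mul, (hV b).eq, (hW b).eq, Matrix.trace_mul_comm]

/-- … hence real. [cite: Balaban1988Convergent, (3.31) p.273] -/
theorem bondInner_im {V W : β → Matrix n n ℂ} (hV : ∀ b, (V b).IsHermitian) (hW : ∀ b, (W b).IsHermitian) :
    (bondInner V W).im = 0 := by
  have h := star_bondInner hV hW
  rw [Complex.star_def] at h
  exact Complex.conj_eq_iff_im.1 h

end Inner

/-! ## §2. (3.32)'s derivative: the product of characteristic functions and its Leibniz expansion -/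

section Chi

variable {β : Type*} [DecidableEq β] {Ω : Type*}

/-- `χ_t^{(k)}(ω) = Π_{b ∈ Λ^{(k)*}_{k+1}} χ^{(k)}(tA(ω)(b))` — the characteristic function with the parameter `t` multiplying the
variables `A`, as a product of per-bond factors `χ b t ω`. [cite: Balaban1988Convergent, (3.32) p.273] -/
def chiProd (star : Finset β) (χ : β → ℝ → Ω → ℝ) (t : ℝ) (ω : Ω) : ℝ := ∏ b ∈ star, χ b t ω

/-- *"(∂/∂t)χ_t^{(k)} can be written as a sum of terms, for which only one characteristic function in the product is
differentiated"*: `Σ_{b} (Π_{b′ ≠ b} χ_{b′}(t, ω)) · (∂_tχ_b)(t, ω)` — the integrand of the middle piece of (3.37).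
[cite: Balaban1988Convergent, (3.32) p.273, (3.37) p.274] -/
def dchiProd (star : Finset β) (χ χ' : β → ℝ → Ω → ℝ) (t : ℝ) (ω : Ω) : ℝ :=
  ∑ b ∈ star, (∏ b' ∈ star.erase b, χ b' t ω) * χ' b t ω

/-- **The Leibniz rule behind (3.32)/(3.37)**: if every factor `t ↦ χ_b(t, ω)` has derivative `χ'_b(t, ω)` at `t`, then
`t ↦ χ_t(ω)` has derivative `dchiProd star χ χ' t ω` at `t`. [cite: Balaban1988Convergent, (3.32) p.273, (3.37) p.274] -/
theorem hasDerivAt_chiProd {star : Finset β} {χ χ' : β → ℝ → Ω → ℝ} {t : ℝ} {ω : Ω}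
    (h : ∀ b ∈ star, HasDerivAt (fun s => χ b s ω) (χ' b t ω) t) :
    HasDerivAt (fun s => chiProd star χ s ω) (dchiProd star χ χ' t ω) t := by
  have := HasDerivAt.fun_finsetProd (u := star) (f := fun b s => χ b s ω) (f' := fun b => χ' b t ω) h
  simpa [chiProd, dchiProd, smul_eq_mul] using this

end Chi

/-! ## §3. (3.37): the per-bond localization `𝐄₀^{(k+1)}(Λ_{k+1}, U_{k+1}, b)` -/

section E0

variable {β : Type*} [Fintype β] [DecidableEq β] {Ω : Type*} [MeasurableSpace Ω]

/-- The middle piece of (3.37) at the bond `b`: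
`∫₀¹ dt ∫ dμ Π_{b′∈Λ*, b′≠b} χ^{(k)}(tA(b′)) (∂/∂t)χ^{(k)}(tA(b)) · (∫ dμ χ_t^{(k)})⁻¹` (ν = `dμ_{C^{(k)}(Λ_{k+1})}`).
[cite: Balaban1988Convergent, (3.37) p.274] -/
def chiBracket (ν : Measure Ω) (star : Finset β) (χ χ' : β → ℝ → Ω → ℝ) (b : β) : ℝ :=
  ∫ t in (0:ℝ)..1, (∫ ω, (∏ b' ∈ star.erase b, χ b' t ω) * χ' b t ω ∂ν) * (∫ ω, chiProd star χ t ω ∂ν)⁻¹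

/-- The last piece of (3.37) at the bond `b` (without the factor `g_k`): `∫₀¹ dt ⟨f_b⟩_t` for an expectation family
`Ex t G = ⟨G⟩_t` (in print `f_b = tr 𝐕_k′(tg_k, A, b)(CA)(b)` and `⟨·⟩_t` the expectation of (3.30)).
[cite: Balaban1988Convergent, (3.37) p.274] -/
def vBracket (Ex : ℝ → (Ω → ℝ) → ℝ) (f : β → ℝ → Ω → ℝ) (b : β) : ℝ :=
  ∫ t in (0:ℝ)..1, Ex t (f b t)

/-- **(3.37)**, structure: `𝐄₀^{(k+1)}(Λ_{k+1}, U_{k+1}, b) = χ_{Λ^{(k)*}_{k+1}}(b)·[gaussB b + chiB b] + g_k · vB b` — the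
Gaussian (log-det) piece `gaussB`, the characteristic-function piece `chiB` (intended `chiBracket ν star χ χ'`) and the
effective-action piece `vB` (intended `vBracket Ex f`). [cite: Balaban1988Convergent, (3.37) p.274] -/
def E0 (star : Finset β) (gaussB chiB : β → ℝ) (g : ℝ) (vB : β → ℝ) (b : β) : ℝ :=
  (if b ∈ star then gaussB b + chiB b else 0) + g * vB b

/-- The bond sum of (3.37) splits into its three pieces:
`Σ_b 𝐄₀(b) = Σ_{b∈Λ*} gaussB b + Σ_{b∈Λ*} chiB b + g Σ_b vB b`. [cite: Balaban1988Convergent, (3.37)–(3.38) p.274] -/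
theorem sum_E0 (star : Finset β) (gaussB chiB : β → ℝ) (g : ℝ) (vB : β → ℝ) :
    ∑ b, E0 star gaussB chiB g vB b = ∑ b ∈ star, gaussB b + ∑ b ∈ star, chiB b + g * ∑ b, vB b := by
  simp only [E0, Finset.sum_add_distrib, Finset.sum_ite_mem, Finset.univ_inter, Finset.mul_sum]

omit [Fintype β] [DecidableEq β] in
/-- Additivity of the tilted expectation `⟨·⟩_t` of (3.27)/(3.30) over a finite bond sum — `⟨Σ_b G_b⟩_t = Σ_b ⟨G_b⟩_t` —
for the tree's instance of record `B14.InterpolationMeasure.gibbsExpect` (each `G_b · w e^{S_t}` integrable).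
[cite: Balaban1988Convergent, (3.30) p.272, (3.31) p.273] -/
theorem gibbsExpect_finset_sum {ν : Measure Ω} {w : Ω → ℝ} {S : ℝ → Ω → ℝ} (s : Finset β) (G : β → Ω → ℝ) (t : ℝ)
    (hG : ∀ b ∈ s, Integrable (fun ω => G b ω * InterpolationMeasure.gibbsWeight w S t ω) ν) :
    InterpolationMeasure.gibbsExpect ν w S (fun ω => ∑ b ∈ s, G b ω) t
      = ∑ b ∈ s, InterpolationMeasure.gibbsExpect ν w S (G b) t := by
  simp only [InterpolationMeasure.gibbsExpect, InterpolationMeasure.gibbsNum]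
  rw [← Finset.sum_div]
  congr 1
  rw [← integral_finsetSum s hG]
  refine integral_congr_ae (ae_of_all _ fun ω => ?_)
  simp only [Finset.sum_mul]

end E0

/-! ## §4. (3.38): "The identities (3.30)–(3.33), (3.36), together with the above definition, imply the equality" -/

section Eq338

variable {β : Type*} [Fintype β] [DecidableEq β] {γ : Type*} [Fintype γ] {Ω : Type*} [MeasurableSpace Ω]

/-- **(3.38)** PROVED as bookkeeping.  Data: the bond type `β = Λ^{(k)}_{k+1}` with the sub-family `star = Λ^{(k)*}_{k+1}`, the
coarse bonds `γ = Λ^{(k+1)}_{k+1}` carrying `z^{(k)}(c)`, the Gaussian measure `ν`, per-bond characteristic factors `χ`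
with `t`-derivatives `χ'`, the expectation family `Ex t = ⟨·⟩_t` and the bond integrands `f b t` of (3.31).  Hypotheses:
`h330` — (3.30) with its last integrand in the bond form (3.31); `h333` — (3.33) with (3.36)/(3.37)₁: the Gaussian logarithm
is `Σ_c log z^{(k)}(c) + Σ_{b∈Λ*} gaussB b + const` (tree: `B14Eq333Proof.eq338_gaussianPart_fiber`); `h332` — (3.32) with
the Leibniz form of `(∂/∂t)χ_t^{(k)}` (tree: `B14.InterpolationMeasure.DomFamily.eq332_family` + `hasDerivAt_chiProd`);
and integrability binders.  Conclusion: `[the logarithm on the right-hand side of (3.28)]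
= Σ_c log z^{(k)}(c) + Σ_b 𝐄₀^{(k+1)}(Λ_{k+1}, b) + const`. [cite: Balaban1988Convergent, (3.38) p.274] -/
theorem eq338 {L gaussLog chiLog const g : ℝ} {logz : γ → ℝ} {star : Finset β} {gaussB : β → ℝ}
    {ν : Measure Ω} {χ χ' : β → ℝ → Ω → ℝ} {Ex : ℝ → (Ω → ℝ) → ℝ} {f : β → ℝ → Ω → ℝ}
    (h330 : L = gaussLog + chiLog + g * ∫ t in (0:ℝ)..1, Ex t (fun ω => ∑ b, f b t ω))
    (h333 : gaussLog = ∑ c, logz c + ∑ b ∈ star, gaussB b + const)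
    (h332 : chiLog = ∫ t in (0:ℝ)..1, (∫ ω, dchiProd star χ χ' t ω ∂ν) * (∫ ω, chiProd star χ t ω ∂ν)⁻¹)
    (hχ : ∀ t ∈ Icc (0:ℝ) 1, ∀ b ∈ star, Integrable (fun ω => (∏ b' ∈ star.erase b, χ b' t ω) * χ' b t ω) ν)
    (hχt : ∀ b ∈ star, IntervalIntegrable
      (fun t => (∫ ω, (∏ b' ∈ star.erase b, χ b' t ω) * χ' b t ω ∂ν) * (∫ ω, chiProd star χ t ω ∂ν)⁻¹) volume 0 1)
    (hEx : ∀ t ∈ Icc (0:ℝ) 1, Ex t (fun ω => ∑ b, f b t ω) = ∑ b, Ex t (f b t))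
    (hft : ∀ b, IntervalIntegrable (fun t => Ex t (f b t)) volume 0 1) :
    L = ∑ c, logz c + ∑ b, E0 star gaussB (chiBracket ν star χ χ') g (vBracket Ex f) b + const := by
  -- the characteristic-function logarithm, bond by bond
  have h2 : chiLog = ∑ b ∈ star, chiBracket ν star χ χ' b := by
    rw [h332]
    unfold chiBracket
    rw [← intervalIntegral.integral_finsetSum hχt]
    refine intervalIntegral.integral_congr fun t ht => ?_
    rw [Set.uIcc_of_le zero_le_one] at ht
    simp only [dchiProd]
    rw [integral_finsetSum star (hχ t ht), Finset.sum_mul]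
  -- the effective-action expectation, bond by bond
  have h3 : ∫ t in (0:ℝ)..1, Ex t (fun ω => ∑ b, f b t ω) = ∑ b, vBracket Ex f b := by
    unfold vBracket
    rw [← intervalIntegral.integral_finsetSum fun b _ => hft b]
    refine intervalIntegral.integral_congr fun t ht => ?_
    rw [Set.uIcc_of_le zero_le_one] at ht
    exact hEx t ht
  rw [h330, h333, h2, h3, sum_E0]
  ring

/-- **(3.38) for the instance of record of `⟨·⟩_t`** (`B14.InterpolationMeasure.gibbsExpect ν' w S`, the tilted expectation
of (3.27)/(3.30) on the same fluctuation-field space, reference measure `ν'`): the additivity hypothesis of `eq338` is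
discharged by `gibbsExpect_finset_sum` from the integrability of each `f_b(t)·w e^{S_t}`.
[cite: Balaban1988Convergent, (3.38) p.274] -/
theorem eq338_gibbs {L gaussLog chiLog const g : ℝ} {logz : γ → ℝ} {star : Finset β}
    {gaussB : β → ℝ} {ν : Measure Ω} {χ χ' : β → ℝ → Ω → ℝ} {ν' : Measure Ω} {w : Ω → ℝ} {S : ℝ → Ω → ℝ}
    {f : β → ℝ → Ω → ℝ}
    (h330 : L = gaussLog + chiLog
      + g * ∫ t in (0:ℝ)..1, InterpolationMeasure.gibbsExpect ν' w S (fun ω => ∑ b, f b t ω) t)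
    (h333 : gaussLog = ∑ c, logz c + ∑ b ∈ star, gaussB b + const)
    (h332 : chiLog = ∫ t in (0:ℝ)..1, (∫ ω, dchiProd star χ χ' t ω ∂ν) * (∫ ω, chiProd star χ t ω ∂ν)⁻¹)
    (hχ : ∀ t ∈ Icc (0:ℝ) 1, ∀ b ∈ star, Integrable (fun ω => (∏ b' ∈ star.erase b, χ b' t ω) * χ' b t ω) ν)
    (hχt : ∀ b ∈ star, IntervalIntegrable
      (fun t => (∫ ω, (∏ b' ∈ star.erase b, χ b' t ω) * χ' b t ω ∂ν) * (∫ ω, chiProd star χ t ω ∂ν)⁻¹) volume 0 1)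
    (hfw : ∀ t ∈ Icc (0:ℝ) 1, ∀ b,
      Integrable (fun ω => f b t ω * InterpolationMeasure.gibbsWeight w S t ω) ν')
    (hft : ∀ b, IntervalIntegrable (fun t => InterpolationMeasure.gibbsExpect ν' w S (f b t) t) volume 0 1) :
    L = ∑ c, logz c
      + ∑ b, E0 star gaussB (chiBracket ν star χ χ') g
          (vBracket (fun t G => InterpolationMeasure.gibbsExpect ν' w S G t) f) b + const := by
  refine eq338 (Ex := fun t G => InterpolationMeasure.gibbsExpect ν' w S G t) h330 h333 h332 hχ hχt ?_ hft
  intro t ht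
  exact gibbsExpect_finset_sum Finset.univ (fun b => f b t) t fun b _ => hfw t ht b

end Eq338

/-! ## §5. (3.41)–(3.42): localization at the coarse sites with the tent weights `h_z` of (3.40) -/

section Eq341

variable {d : ℕ} {Z : Type*} [Fintype Z] {X : Type*} [Fintype X]

/-- **(3.41)** AS PRINTED: `𝐄₀^{(k+1)}(Λ_{k+1}, U_{k+1}, z) = Σ_{μ} [ ½ (log z^{(k)}(⟨z − Le_μ, z⟩) + log z^{(k)}(⟨z, z + Le_μ⟩))
+ Σ_x h_z(x) 𝐄₀^{(k+1)}(Λ_{k+1}, ⟨x, x + e_μ⟩) ]` — coarse sites `z : Z`, fine sites `x : X`; the coarse bond `⟨z, z + Le_μ⟩`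
is `(z, μ)`, `⟨z − Le_μ, z⟩` is `(back μ z, μ)`; the fine bond `⟨x, x + e_μ⟩` is `(x, μ)`; `logz (z, μ) = log z^{(k)}(⟨z, z+Le_μ⟩)`,
`E0b (x, μ) = 𝐄₀^{(k+1)}(Λ_{k+1}, ⟨x, x+e_μ⟩)` ((3.37)), `h z x = h_z(x)` ((3.40)). [cite: Balaban1988Convergent, (3.41) p.275] -/
def E0site (logz : Z × Fin d → ℝ) (h : Z → X → ℝ) (E0b : X × Fin d → ℝ) (back : Fin d → Z → Z) (z : Z) : ℝ :=
  ∑ μ : Fin d, ((1/2 : ℝ) * (logz (back μ z, μ) + logz (z, μ)) + ∑ x, h z x * E0b (x, μ))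

/-- **The resummation behind (3.38) ⇒ (3.42)** on the whole (periodic) lattice: if each backward translation
`z ↦ z − Le_μ` is a bijection of the coarse sites and the tent weights are a decomposition of unity `Σ_z h_z(x) = 1` ((3.40)),
then `Σ_z 𝐄₀(z) = Σ_c log z^{(k)}(c) + Σ_b 𝐄₀(b)` — every coarse bond is shared half-and-half by its two endpoints, every fine
bond is distributed over the sites by `h_z`. [cite: Balaban1988Convergent, (3.41)–(3.42) p.275] -/
theorem sum_E0site (logz : Z × Fin d → ℝ) (h : Z → X → ℝ) (E0b : X × Fin d → ℝ) {back : Fin d → Z → Z}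
    (hback : ∀ μ, Function.Bijective (back μ)) (hh : ∀ x, ∑ z, h z x = 1) :
    ∑ z, E0site logz h E0b back z = ∑ c, logz c + ∑ b, E0b b := by
  unfold E0site
  rw [Finset.sum_comm]
  have hμ : ∀ μ : Fin d,
      ∑ z, ((1/2 : ℝ) * (logz (back μ z, μ) + logz (z, μ)) + ∑ x, h z x * E0b (x, μ))
        = ∑ z, logz (z, μ) + ∑ x, E0b (x, μ) := by
    intro μ
    rw [Finset.sum_add_distrib]
    congr 1
    · rw [← Finset.mul_sum, Finset.sum_add_distrib,
        (hback μ).sum_comp (fun z => logz (z, μ))]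
      ring
    · rw [Finset.sum_comm]
      refine Finset.sum_congr rfl fun x _ => ?_
      rw [← Finset.sum_mul, hh x, one_mul]
  rw [Finset.sum_congr rfl fun μ _ => hμ μ, Finset.sum_add_distrib, Fintype.sum_prod_type_right,
    Fintype.sum_prod_type_right]

/-- **(3.42)**: *"The equality (3.38) implies [the logarithm on the right-hand side of (3.28)] = Σ_{z∈Λ^{(k+1)}_{k+1}}
𝐄₀^{(k+1)}(Λ_{k+1}, z) + const"* — on the whole (periodic) lattice, with the same constant.
[cite: Balaban1988Convergent, (3.42) p.275] -/
theorem eq342 {L const : ℝ} (logz : Z × Fin d → ℝ) (h : Z → X → ℝ) (E0b : X × Fin d → ℝ) {back : Fin d → Z → Z}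
    (h338 : L = ∑ c, logz c + ∑ b, E0b b + const)
    (hback : ∀ μ, Function.Bijective (back μ)) (hh : ∀ x, ∑ z, h z x = 1) :
    L = ∑ z, E0site logz h E0b back z + const := by
  rw [h338, sum_E0site logz h E0b hback hh]

end Eq341

end Literature.MathematicalPhysics.QuantumFieldTheory.Balaban1983to89.B14.Eq338Localization
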